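import Literature.NumberTheory.Transcendental.LinGroupZESubgroups
import Literature.NumberTheory.Transcendental.GaGmSubgroupDegrees
import Literature.RingTheory.KrullDimension.AffineDimension
import Literature.NumberTheory.Transcendental.PhilipponZeroEstimateP1nDescent
import Mathlib.LinearAlgebra.Dual.Lemmas
import Mathlib.RingTheory.AlgebraicIndependent.TranscendenceBasis
import HarnessLib

/-!
# Connected subgroups `E × T_A` of `𝔾ₐ^{d₀} × 𝔾ₘ^{d₁}`: dimension and degree, and Philippon's descent at `T = 0`

## Dimension and degree of the connected subgroups `E × T_A` of `𝔾ₐ^{d₀} × 𝔾ₘ^{d₁}`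

Topic `Literature/NumberTheory/Transcendental`. Fourth module of the port of the tree's proof of
Philippon's zero estimate with multiplicities from `𝔾ₐ × 𝔾ₘⁿ` (`GaGmSubgroupDegrees.lean`) to
`𝔾ₐ^{d₀} × 𝔾ₘ^{d₁}` (`LinGroup d₀ d₁`), owed to `Literature.Barriers.Schanuel.roy1992_thm1`.
For an irreducible closed subgroup `H₀ ≤ ℂ^{d₀} × (ℂˣ)^{d₁}`, identified with
`𝓗 = LinGroup.toConnAlgSubgroup H₀ _ = E × T_A` (`LinGroupZESubgroups.lean`), this file PROVES

* `LinGroup.dimG_eq_addDim_add_torusDim` : `dim H₀ = dim E + dim T_A`;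
* `LinGroup.pow_le_mult` : `mult_{D₀,D₁}(H₀) ≥ D₀^{dim E} · D₁^{dim T_A}` for the box-degree
  multiplicity `LinGroup.mult` of `LinGroupZEBezout.lean`.

The lattice data of `A = charGroup H₀ ≤ ℤ^{d₁}` (`GaGm.exists_latticeData`, `GaGm.tangentOf`,
`GaGm.finrank_tangentOf`, `GaGm.cvHom`, `GaGm.zpow_eq_prod_of_relation`,
`GaGm.eq_zero_of_tendsto_of_mul_le`) are reused verbatim from `GaGmSubgroupDegrees.lean` (they
concern `ℤ^{d₁}` only). New for `d₀ > 1` is the **coordinate data of the additive part**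
(`LinGroup.exists_coordData`): a set `I` of `dim E` additive coordinates which restrict to a basis
of the dual of `E` — every `X_k` is, on `E`, a combination of the `X_i`, `i ∈ I` (upper bound
`dim H₀ ≤ #I + #Jc` by transcendence degree, `dimG_le_addDim_add_card`), and `E → ℂ^I` is onto
(lower bound `H_{H₀}(t) ≥ (tD₀+1)^{#I} (tD₁+1)^{#Jc}`: the box monomials in `X_i (i ∈ I)`,
`Y_j (j ∈ Jc)` are independent modulo `𝔍(H₀)`, `pow_mul_pow_le_hilb`).

## Philippon's descent at `T = 0` on `𝔾ₐ^{d₀} × 𝔾ₘ^{d₁}` (Philippon 1986, §5)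

Topic `Literature/NumberTheory/Transcendental`. Port to `LinGroup d₀ d₁` (index `Fin d₀ ⊕ Fin d₁`)
of the tree's `PhilipponZeroEstimateP1nDescent.lean` (the case `d₀ = 1`), for the zero estimate
owed to `Literature.Barriers.Schanuel.roy1992_thm1`: the combinatorial-geometric heart of the
descent in Philippon's zero estimate (Philippon 1986, §5, pp. 380–383, specialised to `T = 0`,
`G = 𝔾ₐ^{d₀} × 𝔾ₘ^{d₁} ⊂ (ℙ¹)^{d₀+d₁}`, `cᵢ = 1`), on the toolkit `LinGroupZEZariski` /
`LinGroupZEBezout` / `LinGroupZESubgroups`. Everything here is PROVED; no named facts.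

`LinGroup.exists_obstruction_subgroup`: let `D₀, D₁ ≥ 1`, `Σ ⊆ G(ℂ)` finite with `e ∈ Σ`, and
`P ≠ 0` a box polynomial (`P ∈ Box(D₀, D₁; 1)`) vanishing on `Σ(d)`, `d = d₀ + d₁`. Then there is an
irreducible closed subgroup `H₀ ≤ G(ℂ)` which (a) is a component of the zero set of a family of
box polynomials `F ⊆ Box(D₀, D₁; 1)` ("incomplètement défini par des équations de multidegrés
`≤ (D₀, D₁, …, D₁)`"), (b) is contained in a translate of `Z(P)`, and (c) satisfies the Bézout
count `card((Σ·H₀)/H₀) · mult_{D₀,D₁}(H₀) ≤ d! D₀^{d₀} D₁^{d₁}`.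

Proof (Philippon §5 at `T = 0`): the zero sets `Z_r = {g ; P(γg) = 0 ∀ γ ∈ Σ(r)}`,
`0 ≤ r ≤ d`, decrease, contain `e`, and `Z_0 = Z(P) ≠ G`, so `dim Z_0 ≤ d - 1` and two consecutive
dimensions agree, `dim Z_r = dim Z_{r+1}` (`GaGm.Descent.exists_eq_succ_of_antitone`, reused from the `d₀ = 1` file). A top-dimensional
component `V` of `Z_{r+1}` has all its `Σ`-translates among the top-dimensional components of
`Z_r` (`σ Z_{r+1} ⊆ Z_r`). Let `E = {g ; gV ⊆ Z_r}` — the zero set of the translates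
`f(v ·)`, `v ∈ V`, `f` a generator of `Z_r`, all box polynomials — and `St = {g ; gV = V}` the
stabiliser of `V` (`MulAction.stabilizer`, a closed subgroup: `Descent.isClosedG_stabilizer`), `H₀ = St⁰` its identity component
(`LinGroup.idComp`). Then `Σ ⊆ E`, `E` is a finite union of cosets of `St` (they correspond to
components of `Z_r`), hence of `H₀` (finite index), so `dim E = dim H₀` and every coset `σH₀`,
`σ ∈ Σ`, is a top-dimensional component of `E`; the Bézout inequality
`LinGroup.sum_mult_le_of_subset_Box` for `E` and translation invariance of `mult` give (c); (b) holds
with the translate by any point of `V ⊆ Z(P)`; (a) holds with `F` the generators of `E`.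

## References

* Yu. V. Nesterenko, P. Philippon (eds.), LNM 1752 (2001), Ch. 11 (D. Roy), §4; Ch. 5–7.
  [NesterenkoPhilippon2001]
* P. Philippon, Bull. Soc. Math. France 114 (1986), 355–383, Prop. 3.3, §4. [Philippon1986]
* M. Waldschmidt, New Advances in Transcendence Theory (1988), 375–398, §7. [Waldschmidt1988]
* A. Borel, *Linear Algebraic Groups*, GTM 126, §8.5 (characters of diagonalizable groups).
* P. Philippon, *Lemmes de zéros dans les groupes algébriques commutatifs*, Bull. Soc. Math.
  France 114 (1986), 355–383, §5 pp. 380–383 (the ideals `I_r`, the set `H_V(0)`, Lemme 5.1).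
  [Philippon1986]
* Yu. V. Nesterenko, P. Philippon (eds.), LNM 1752 (2001), Ch. 11 (D. Roy), §4 (proof of
  Thm 4.1). [NesterenkoPhilippon2001]
-/
noncomputable section

open MvPolynomial Module
open scoped Pointwise

namespace Literature.NumberTheory.Transcendental

namespace LinGroup

variable {d₀ d₁ : ℕ}

/-! ### Coordinate data of a subspace of `ℂ^{d₀}` -/

/-- **Coordinate data.** For a subspace `E ⊆ ℂ^{d₀}` there is a set `I` of `dim E` coordinates
such that on `E` every coordinate `x_k` is a linear combination of the `x_i`, `i ∈ I`, and the
projection `E → ℂ^I` is onto (the restrictions of the `x_i`, `i ∈ I`, form a basis of the dual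
of `E`). [folklore] -/
theorem exists_coordData (E : Submodule ℂ (Fin d₀ → ℂ)) :
    ∃ I : Finset (Fin d₀), I.card = finrank ℂ ↥E ∧
      (∀ k : Fin d₀, ∃ c : Fin d₀ → ℂ, ∀ x ∈ E, x k = ∑ i ∈ I, c i * x i) ∧
      (∀ z : Fin d₀ → ℂ, ∃ x ∈ E, ∀ i ∈ I, x i = z i) := by
  classical
  -- the coordinate functionals on `E`
  set w : Fin d₀ → Module.Dual ℂ ↥E := fun i => (LinearMap.proj i).comp E.subtype with hw
  have hw_apply : ∀ (i : Fin d₀) (x : ↥E), w i x = (x : Fin d₀ → ℂ) i := fun i x => rfl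
  -- they span the dual
  have hspan : ∀ φ : Module.Dual ℂ ↥E, φ ∈ Submodule.span ℂ (Set.range w) := by
    intro φ
    obtain ⟨ψ, hψ⟩ := LinearMap.dualMap_surjective_of_injective (f := E.subtype) E.injective_subtype φ
    have hφ : φ = ∑ i, ψ (Pi.single i 1) • w i := by
      rw [← hψ]
      refine LinearMap.ext fun x => ?_
      rw [LinearMap.dualMap_apply, LinearMap.pi_apply_eq_sum_univ ψ, LinearMap.sum_apply]
      refine Finset.sum_congr rfl fun i _ => ?_
      rw [LinearMap.smul_apply, hw_apply, smul_eq_mul, smul_eq_mul, mul_comm]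
      congr 2
      funext j
      by_cases h : i = j
      · subst h; simp
      · rw [if_neg h, Pi.single_eq_of_ne' h]
    rw [hφ]
    exact Submodule.sum_mem _ fun i _ => Submodule.smul_mem _ _ (Submodule.subset_span ⟨i, rfl⟩)
  -- a maximal independent subfamily
  obtain ⟨s, hli, hmax⟩ := exists_maximal_linearIndepOn ℂ w
  haveI : Fintype ↥s := Fintype.ofFinite _
  have hmem : ∀ k, w k ∈ Submodule.span ℂ (w '' s) := by
    intro k
    by_cases hks : k ∈ s
    · exact Submodule.subset_span ⟨k, hks, rfl⟩
    · obtain ⟨a, ha, hmem⟩ := hmax k hks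
      have := Submodule.smul_mem _ a⁻¹ hmem
      rwa [smul_smul, inv_mul_cancel₀ ha, one_smul] at this
  have hspan_s : Submodule.span ℂ (w '' s) = ⊤ := by
    rw [eq_top_iff]
    intro φ _
    refine (Submodule.span_le.mpr ?_) (hspan φ)
    rintro _ ⟨k, rfl⟩
    exact hmem k
  -- cardinality
  have hcard : Fintype.card ↥s = finrank ℂ ↥E := by
    have h1 := finrank_span_eq_card hli.linearIndependent
    have h2 : Set.range (fun i : ↥s => w i) = w '' s := by
      ext φ; simp
    rw [h2, hspan_s, finrank_top, Subspace.dual_finrank_eq] at h1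
    exact h1.symm
  refine ⟨s.toFinset, by rw [Set.toFinset_card, hcard], fun k => ?_, fun z => ?_⟩
  · -- `x_k` is a combination of the `x_i`, `i ∈ s`, on `E`
    have hk := hmem k
    rw [show w '' s = w '' ↑s.toFinset by rw [Set.coe_toFinset]] at hk
    rw [Submodule.mem_span_image_finset_iff_exists_fun'] at hk
    obtain ⟨c, hc⟩ := hk
    refine ⟨c, fun x hx => ?_⟩
    have := congrArg (fun φ : Module.Dual ℂ ↥E => φ ⟨x, hx⟩) hc
    simp only [LinearMap.sum_apply, LinearMap.smul_apply, hw_apply, smul_eq_mul] at this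
    exact this.symm
  · -- `E → ℂ^s` is onto
    set L : ↥E →ₗ[ℂ] (↥s → ℂ) :=
      { toFun := fun x i => (x : Fin d₀ → ℂ) i
        map_add' := fun x y => by funext i; simp
        map_smul' := fun c x => by funext i; simp } with hL
    have hLinj : Function.Injective L := by
      rw [← LinearMap.ker_eq_bot, LinearMap.ker_eq_bot']
      intro x hx
      have hφ : ∀ φ : Module.Dual ℂ ↥E, φ x = 0 := by
        intro φ
        have hφmem : φ ∈ Submodule.span ℂ (w '' s) := by rw [hspan_s]; trivial
        refine Submodule.span_induction ?_ ?_ ?_ ?_ hφmem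
        · rintro _ ⟨i, hi, rfl⟩
          exact congrFun hx ⟨i, hi⟩
        · rfl
        · intro φ₁ φ₂ _ _ h₁ h₂; rw [LinearMap.add_apply, h₁, h₂, add_zero]
        · intro a φ₁ _ h₁; rw [LinearMap.smul_apply, h₁, smul_zero]
      exact (Module.forall_dual_apply_eq_zero_iff ℂ x).mp hφ
    have hLsurj : Function.Surjective L := by
      haveI : FiniteDimensional ℂ ↥E := inferInstance
      refine (LinearMap.injective_iff_surjective_of_finrank_eq_finrank ?_).mp hLinj
      rw [Module.finrank_fintype_fun_eq_card, hcard]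
    obtain ⟨x, hx⟩ := hLsurj (fun i => z i)
    refine ⟨x, x.2, fun i hi => ?_⟩
    rw [Set.mem_toFinset] at hi
    exact congrFun hx ⟨i, hi⟩

/-! ### The torus tangent space -/

/-- `GaGm.tangentOf` is literally `ConnAlgSubgroup.torusTangent`. [folklore] -/
theorem torusTangent_eq_tangentOf (𝓗 : ConnAlgSubgroup d₀ d₁) : 𝓗.torusTangent = GaGm.tangentOf 𝓗.chars := rfl

/-! ### Upper bound for the dimension of a connected subgroup (transcendence degree) -/

/-- The additive coordinates of an element of a closed subgroup lie in its additive part.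
[folklore] -/
theorem toAdd_fst_mem_addSubspace (H₀ : Subgroup (LinGroup d₀ d₁)) (hH : IsClosedG (H₀ : Set (LinGroup d₀ d₁)))
    {g : LinGroup d₀ d₁} (hg : g ∈ H₀) : Multiplicative.toAdd g.1 ∈ addSubspace H₀ hH := by
  rw [mem_addSubspace_iff, ofAdd_toAdd]
  have hs := torusPart_mem H₀ hH hg
  have : (g.1, (1 : Fin d₁ → ℂˣ)) = g * ((1 : Multiplicative (Fin d₀ → ℂ)), g.2)⁻¹ := by ext <;> simp
  rw [this]; exact H₀.mul_mem hg (H₀.inv_mem hs)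

/-- The coordinate `Y_j` is non-zero in `ℂ[X, Y] ⧸ 𝔍(H₀)`. [folklore] -/
theorem mk_X_inr_ne_zero (H₀ : Subgroup (LinGroup d₀ d₁)) (j : Fin d₁) :
    Ideal.Quotient.mk (vanishing (H₀ : Set (LinGroup d₀ d₁))) (X (Sum.inr j)) ≠ 0 := by
  intro h
  rw [Ideal.Quotient.eq_zero_iff_mem] at h
  have := h 1 H₀.one_mem
  simp [evalAt_eq_eval] at this

/-- **`dim H₀ ≤ #I + #Jc`.** The coordinates `X_k` (all `k`) and `Y_k`, `k ∉ Jc`, of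
`ℂ[X, Y] ⧸ 𝔍(H₀)` are algebraic over `ℂ[X_i (i ∈ I), Y_j (j ∈ Jc)]`: the former are linear
combinations of the `X_i` modulo `𝔍(H₀)` (coordinate data of the additive part), the latter
thanks to the relations `N e_k = μ + ∑ d_j e_j`, `μ` trivial on `H₀`; so the transcendence
degree, which is the Krull dimension (`Literature.RingTheory.KrullDimension.ringKrullDim_eq_trdeg`),
is at most `#I + #Jc` (`Algebra.IsAlgebraic.trdeg_le_cardinalMk`). [folklore] -/
theorem dimG_le_card_add_card (H₀ : Subgroup (LinGroup d₀ d₁)) (hirr : IsIrred (H₀ : Set (LinGroup d₀ d₁)))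
    {I : Finset (Fin d₀)}
    (hI : ∀ k : Fin d₀, ∃ c : Fin d₀ → ℂ, ∀ x ∈ addSubspace H₀ hirr.isClosedG, x k = ∑ i ∈ I, c i * x i)
    {r : ℕ} {b : Fin r → (Fin d₁ → ℤ)} {Jc : Finset (Fin d₁)} (hbA : ∀ i, b i ∈ charGroup (H₀ : Set (LinGroup d₀ d₁)))
    (hrel : ∀ k : Fin d₁, ∃ (N : ℕ) (m : Fin r → ℤ) (d : ↥Jc → ℤ), 0 < N ∧
      (N : ℤ) • (Pi.single k (1 : ℤ) : Fin d₁ → ℤ) = ∑ i, m i • b i + ∑ j, d j • Pi.single (j : Fin d₁) (1 : ℤ)) :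
    dimG (H₀ : Set (LinGroup d₀ d₁)) ≤ I.card + Jc.card := by
  classical
  haveI := hirr.isPrime
  set 𝔭 := vanishing (H₀ : Set (LinGroup d₀ d₁)) with h𝔭
  haveI : IsDomain (MvPolynomial (Fin d₀ ⊕ Fin d₁) ℂ ⧸ 𝔭) := Ideal.Quotient.isDomain _
  set mk : MvPolynomial (Fin d₀ ⊕ Fin d₁) ℂ →ₐ[ℂ] MvPolynomial (Fin d₀ ⊕ Fin d₁) ℂ ⧸ 𝔭 := Ideal.Quotient.mkₐ ℂ 𝔭 with hmk
  have hmk' : ∀ Q, mk Q = Ideal.Quotient.mk 𝔭 Q := fun Q => rfl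
  -- the small generating set
  set T : Finset (MvPolynomial (Fin d₀ ⊕ Fin d₁) ℂ ⧸ 𝔭) :=
    I.image (fun i => mk (X (Sum.inl i))) ∪ Jc.image (fun j => mk (X (Sum.inr j))) with hT
  have hTcard : T.card ≤ I.card + Jc.card := by
    rw [hT]
    exact (Finset.card_union_le _ _).trans (Nat.add_le_add Finset.card_image_le Finset.card_image_le)
  have hTmemX : ∀ i ∈ I, mk (X (Sum.inl i)) ∈ Algebra.adjoin ℂ (↑T : Set (MvPolynomial (Fin d₀ ⊕ Fin d₁) ℂ ⧸ 𝔭)) := by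
    intro i hi
    refine Algebra.subset_adjoin ?_
    rw [Finset.mem_coe, hT, Finset.mem_union]
    exact Or.inl (Finset.mem_image_of_mem _ hi)
  have hTmem : ∀ j ∈ Jc, mk (X (Sum.inr j)) ∈ Algebra.adjoin ℂ (↑T : Set (MvPolynomial (Fin d₀ ⊕ Fin d₁) ℂ ⧸ 𝔭)) := by
    intro j hj
    refine Algebra.subset_adjoin ?_
    rw [Finset.mem_coe, hT, Finset.mem_union]
    exact Or.inr (Finset.mem_image_of_mem _ hj)
  -- all the generators
  set S : Set (MvPolynomial (Fin d₀ ⊕ Fin d₁) ℂ ⧸ 𝔭) := Set.range (mk ∘ X) with hS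
  have hSgen : Algebra.adjoin ℂ S = ⊤ := by
    rw [hS, Set.range_comp, Algebra.adjoin_image, MvPolynomial.adjoin_range_X, Algebra.map_top,
      AlgHom.range_eq_top]
    exact Ideal.Quotient.mkₐ_surjective ℂ _
  -- every generator outside `T` is algebraic over `ℂ[T]`
  have halgT : ∀ x ∈ S \ (↑T : Set (MvPolynomial (Fin d₀ ⊕ Fin d₁) ℂ ⧸ 𝔭)),
      IsAlgebraic (Algebra.adjoin ℂ (↑T : Set (MvPolynomial (Fin d₀ ⊕ Fin d₁) ℂ ⧸ 𝔭))) x := by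
    rintro x ⟨⟨v, rfl⟩, hxT⟩
    revert hxT
    rcases v with k | k
    · -- `X_k`: a linear combination of the `X_i`, `i ∈ I`, modulo `𝔭`
      intro _
      obtain ⟨c, hc⟩ := hI k
      have hdiff : mk (X (Sum.inl k)) = mk (∑ i ∈ I, C (c i) * X (Sum.inl i)) := by
        rw [hmk', hmk', ← sub_eq_zero, ← map_sub, Ideal.Quotient.eq_zero_iff_mem]
        intro g hg
        have hx := hc _ (toAdd_fst_mem_addSubspace H₀ hirr.isClosedG hg)
        rw [evalAt_eq_eval]
        simp only [map_sub, map_sum, map_mul, MvPolynomial.eval_C, MvPolynomial.eval_X, coord_inl]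
        rw [hx, sub_self]
      have hmem : (mk ∘ X) (Sum.inl k) ∈ Algebra.adjoin ℂ (↑T : Set (MvPolynomial (Fin d₀ ⊕ Fin d₁) ℂ ⧸ 𝔭)) := by
        change mk (X (Sum.inl k)) ∈ _
        rw [hdiff, map_sum]
        refine Subalgebra.sum_mem _ fun i hi => ?_
        rw [map_mul, MvPolynomial.algHom_C]
        exact Subalgebra.mul_mem _ (Subalgebra.algebraMap_mem _ _) (hTmemX i hi)
      exact isAlgebraic_algebraMap
        (R := Algebra.adjoin ℂ (↑T : Set (MvPolynomial (Fin d₀ ⊕ Fin d₁) ℂ ⧸ 𝔭))) (x := (⟨_, hmem⟩ : Algebra.adjoin ℂ _))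
    · intro hxT
      by_cases hk : k ∈ Jc
      · exfalso; apply hxT
        rw [Finset.mem_coe, hT, Finset.mem_union]; right
        exact Finset.mem_image_of_mem _ hk
      change IsAlgebraic _ (mk (X (Sum.inr k)))
      -- the relation for `Y_k`
      obtain ⟨N, m, d, hN, hrelk⟩ := hrel k
      set u : MvPolynomial (Fin d₀ ⊕ Fin d₁) ℂ ⧸ 𝔭 := ∏ j : ↥Jc, mk (X (Sum.inr (j : Fin d₁))) ^ (-d j).toNat with hu
      set v : MvPolynomial (Fin d₀ ⊕ Fin d₁) ℂ ⧸ 𝔭 := ∏ j : ↥Jc, mk (X (Sum.inr (j : Fin d₁))) ^ (d j).toNat with hv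
      have humem : u ∈ Algebra.adjoin ℂ (↑T : Set (MvPolynomial (Fin d₀ ⊕ Fin d₁) ℂ ⧸ 𝔭)) :=
        Subalgebra.prod_mem _ fun j _ => Subalgebra.pow_mem _ (hTmem j j.2) _
      have hvmem : v ∈ Algebra.adjoin ℂ (↑T : Set (MvPolynomial (Fin d₀ ⊕ Fin d₁) ℂ ⧸ 𝔭)) :=
        Subalgebra.prod_mem _ fun j _ => Subalgebra.pow_mem _ (hTmem j j.2) _
      have hu0 : u ≠ 0 := Finset.prod_ne_zero_iff.mpr fun j _ => pow_ne_zero _ (mk_X_inr_ne_zero H₀ _)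
      -- the relation in the quotient: `Y_k^N · u = v`
      have hrelR : mk (X (Sum.inr k)) ^ N * u = v := by
        rw [hu, hv]
        simp only [hmk', ← map_pow, ← map_prod, ← map_mul]
        rw [← sub_eq_zero, ← map_sub, Ideal.Quotient.eq_zero_iff_mem]
        intro g hg
        have hy : (g.2 k) ^ (N : ℤ) = ∏ j : ↥Jc, (g.2 j) ^ (d j) :=
          GaGm.zpow_eq_prod_of_relation (fun i => hbA i g hg) hrelk
        -- in `ℂˣ`: `y_k^N ∏ y_j^{(-d)⁺} = ∏ y_j^{d⁺}`
        have hy' : (g.2 k) ^ N * ∏ j : ↥Jc, (g.2 j) ^ (-d j).toNat = ∏ j : ↥Jc, (g.2 j) ^ (d j).toNat := by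
          rw [← zpow_natCast, hy, ← Finset.prod_mul_distrib]
          refine Finset.prod_congr rfl fun j _ => ?_
          rw [← zpow_natCast, ← zpow_natCast, ← zpow_add]
          congr 1
          omega
        have hyC := congrArg (fun w : ℂˣ => (w : ℂ)) hy'
        rw [evalAt_eq_eval]
        simp only [map_sub, map_mul, map_pow, map_prod, MvPolynomial.eval_X, coord_inr, sub_eq_zero]
        push_cast at hyC
        exact hyC
      -- the polynomial `u Z^N - v`
      set K := Algebra.adjoin ℂ (↑T : Set (MvPolynomial (Fin d₀ ⊕ Fin d₁) ℂ ⧸ 𝔭)) with hK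
      set p : Polynomial ↥K := Polynomial.C (⟨u, humem⟩ : ↥K) * Polynomial.X ^ N - Polynomial.C ⟨v, hvmem⟩ with hp
      refine ⟨p, ?_, ?_⟩
      · intro h0
        have h1 := congrArg (fun q : Polynomial ↥K => q.coeff N) h0
        simp only [hp] at h1
        rw [Polynomial.coeff_sub, Polynomial.coeff_C_mul_X_pow, if_pos rfl, Polynomial.coeff_C,
          if_neg (Nat.pos_iff_ne_zero.mp hN), sub_zero, Polynomial.coeff_zero] at h1
        exact hu0 (congrArg Subtype.val h1)
      · simp only [hp, map_sub, map_mul, Polynomial.aeval_C, Polynomial.aeval_X, map_pow, Subalgebra.algebraMap_def]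
        change u * mk (X (Sum.inr k)) ^ N - v = 0
        rw [mul_comm, hrelR, sub_self]
  -- conclude with transcendence degree = dimension
  have halgS : ∀ a : MvPolynomial (Fin d₀ ⊕ Fin d₁) ℂ ⧸ 𝔭, IsAlgebraic (Algebra.adjoin ℂ S) a := fun a => by
    have ha : a ∈ Algebra.adjoin ℂ S := by rw [hSgen]; exact Algebra.mem_top
    exact isAlgebraic_algebraMap (R := Algebra.adjoin ℂ S) (x := (⟨a, ha⟩ : Algebra.adjoin ℂ S))
  haveI : Algebra.IsAlgebraic (Algebra.adjoin ℂ (↑T : Set (MvPolynomial (Fin d₀ ⊕ Fin d₁) ℂ ⧸ 𝔭)))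
      (MvPolynomial (Fin d₀ ⊕ Fin d₁) ℂ ⧸ 𝔭) :=
    ⟨fun a => IsAlgebraic.adjoin_of_forall_isAlgebraic halgT (halgS a)⟩
  have htr : Algebra.trdeg ℂ (MvPolynomial (Fin d₀ ⊕ Fin d₁) ℂ ⧸ 𝔭) ≤ T.card := by
    have h := Algebra.IsAlgebraic.trdeg_le_cardinalMk ℂ (A := MvPolynomial (Fin d₀ ⊕ Fin d₁) ℂ ⧸ 𝔭)
      (↑T : Set (MvPolynomial (Fin d₀ ⊕ Fin d₁) ℂ ⧸ 𝔭))
    rwa [Finset.coe_sort_coe, Cardinal.mk_coe_finset] at h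
  have hdim := Literature.RingTheory.KrullDimension.ringKrullDim_eq_trdeg ℂ (MvPolynomial (Fin d₀ ⊕ Fin d₁) ℂ ⧸ 𝔭)
  rw [← dimG_eq hirr.nonempty] at hdim
  have hd : dimG (H₀ : Set (LinGroup d₀ d₁)) = Cardinal.toNat (Algebra.trdeg ℂ (MvPolynomial (Fin d₀ ⊕ Fin d₁) ℂ ⧸ 𝔭)) := by
    exact_mod_cast hdim
  rw [hd]
  refine le_trans ?_ hTcard
  have := Cardinal.toNat_le_toNat htr (Cardinal.natCast_lt_aleph0)
  rwa [Cardinal.toNat_natCast] at this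

/-! ### Lower bound for the Hilbert function of a connected subgroup -/

/-- Evaluation of a monomial at a point of `G(ℂ)`. [folklore] -/
theorem evalAt_monomial (s : (Fin d₀ ⊕ Fin d₁) →₀ ℕ) (c : ℂ) (g : LinGroup d₀ d₁) :
    evalAt (monomial s c) g = c * (addVal (Multiplicative.toAdd g.1) s * charVal g.2 s) := by
  classical
  rw [evalAt_eq_eval, MvPolynomial.eval_monomial, Finsupp.prod_fintype _ _ (fun i => by simp), Fintype.prod_sum_type]
  simp [coord, charVal, addVal]

/-- Points `(x, y)` with `x` in the additive part and `(0, y) ∈ H₀` lie in `H₀`. [folklore] -/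
theorem mem_of_mem_addSubspace (H₀ : Subgroup (LinGroup d₀ d₁)) (hH : IsClosedG (H₀ : Set (LinGroup d₀ d₁)))
    {x : Fin d₀ → ℂ} (hx : x ∈ addSubspace H₀ hH) {y : Fin d₁ → ℂˣ}
    (hy : ((1 : Multiplicative (Fin d₀ → ℂ)), y) ∈ H₀) : (Multiplicative.ofAdd x, y) ∈ H₀ := by
  have : ((Multiplicative.ofAdd x, y) : LinGroup d₀ d₁) =
      (Multiplicative.ofAdd x, (1 : Fin d₁ → ℂˣ)) * ((1 : Multiplicative (Fin d₀ → ℂ)), y) := by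
    ext <;> simp
  rw [this]; exact H₀.mul_mem hx hy

/-- The exponents of the independent box monomials `∏_{i ∈ I} X_i^{α_i} ∏_{j ∈ Jc} Y_j^{c_j}`.
[folklore] -/
def boxExp (I : Finset (Fin d₀)) (Jc : Finset (Fin d₁)) {T₀ T : ℕ} (ic : (↥I → Fin T₀) × (↥Jc → Fin T)) :
    (Fin d₀ ⊕ Fin d₁) →₀ ℕ :=
  Finsupp.equivFunOnFinite.symm (Sum.elim (fun i => if h : i ∈ I then ((ic.1 ⟨i, h⟩ : Fin T₀) : ℕ) else 0)
    (fun l => if h : l ∈ Jc then ((ic.2 ⟨l, h⟩ : Fin T) : ℕ) else 0))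

/-- The `X`-exponents of `boxExp`. [folklore] -/
theorem boxExp_inl (I : Finset (Fin d₀)) (Jc : Finset (Fin d₁)) {T₀ T : ℕ} (ic : (↥I → Fin T₀) × (↥Jc → Fin T)) (i : Fin d₀) :
    boxExp I Jc ic (Sum.inl i) = if h : i ∈ I then ((ic.1 ⟨i, h⟩ : Fin T₀) : ℕ) else 0 := by
  simp [boxExp]

/-- The `Y`-exponents of `boxExp`. [folklore] -/
theorem boxExp_inr (I : Finset (Fin d₀)) (Jc : Finset (Fin d₁)) {T₀ T : ℕ} (ic : (↥I → Fin T₀) × (↥Jc → Fin T)) (l : Fin d₁) :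
    boxExp I Jc ic (Sum.inr l) = if h : l ∈ Jc then ((ic.2 ⟨l, h⟩ : Fin T) : ℕ) else 0 := by
  simp [boxExp]

/-- `boxExp` is injective. [folklore] -/
theorem boxExp_injective (I : Finset (Fin d₀)) (Jc : Finset (Fin d₁)) {T₀ T : ℕ} :
    Function.Injective (boxExp I Jc (T₀ := T₀) (T := T)) := by
  intro ic ic' h
  refine Prod.ext (funext fun i => Fin.ext ?_) (funext fun j => Fin.ext ?_)
  · have := congrArg (fun s => s (Sum.inl (i : Fin d₀))) h
    simpa [boxExp_inl, i.2] using this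
  · have := congrArg (fun s => s (Sum.inr (j : Fin d₁))) h
    simpa [boxExp_inr, j.2] using this

/-- The additive value of a `boxExp` monomial: `x^{α} = ∏_{i ∈ I} x_i^{α_i}`. [folklore] -/
theorem addVal_boxExp (I : Finset (Fin d₀)) (Jc : Finset (Fin d₁)) {T₀ T : ℕ} (ic : (↥I → Fin T₀) × (↥Jc → Fin T))
    (x : Fin d₀ → ℂ) : addVal x (boxExp I Jc ic) = ∏ i : ↥I, x i ^ ((ic.1 i : Fin T₀) : ℕ) := by
  classical
  unfold addVal
  rw [← Finset.prod_subset (Finset.subset_univ I) (fun i _ hi => by rw [boxExp_inl, dif_neg hi, pow_zero]),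
    ← Finset.prod_coe_sort I]
  refine Finset.prod_congr rfl fun i _ => ?_
  rw [boxExp_inl, dif_pos i.2]

/-- The exponent in the `I`-variables attached to `α : I → Fin T₀`. [folklore] -/
def expI (I : Finset (Fin d₀)) {T₀ : ℕ} (α : ↥I → Fin T₀) : ↥I →₀ ℕ :=
  Finsupp.equivFunOnFinite.symm fun i => ((α i : Fin T₀) : ℕ)

/-- `expI` is injective. [folklore] -/
theorem expI_injective (I : Finset (Fin d₀)) {T₀ : ℕ} : Function.Injective (expI I (T₀ := T₀)) := by
  intro α α' h
  funext i
  apply Fin.ext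
  have := congrArg (fun s => s i) h
  simpa [expI] using this

/-- **Lower bound `H_{H₀}(t) ≥ (tD₀+1)^{#I} (tD₁+1)^{#Jc}`**: the box monomials
`∏_{i ∈ I} X_i^{α_i} ∏_{j ∈ Jc} Y_j^{c_j}` are linearly independent modulo `𝔍(H₀)` (polynomial
identity in the `X_i`, `i ∈ I`, on the additive part — onto `ℂ^I` — then distinct characters of
`H₀` — distinct because a difference supported on `Jc` and lying in `charGroup H₀ ⊗ ℚ` vanishes —
are independent by Artin). [folklore] -/
theorem pow_mul_pow_le_hilb (D₀ D₁ : ℕ) (H₀ : Subgroup (LinGroup d₀ d₁)) (hirr : IsIrred (H₀ : Set (LinGroup d₀ d₁)))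
    {I : Finset (Fin d₀)} (hI : ∀ z : Fin d₀ → ℂ, ∃ x ∈ addSubspace H₀ hirr.isClosedG, ∀ i ∈ I, x i = z i)
    {r : ℕ} {b : Fin r → (Fin d₁ → ℤ)} {Jc : Finset (Fin d₁)}
    (hli : LinearIndependent ℂ (Sum.elim (fun i => GaGm.castC (b i)) (fun j : ↥Jc => Pi.single (j : Fin d₁) (1 : ℂ))))
    (hspan : ∀ χ ∈ charGroup (H₀ : Set (LinGroup d₀ d₁)), GaGm.castQ χ ∈ Submodule.span ℚ (Set.range fun i => GaGm.castQ (b i)))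
    (t : ℕ) :
    (t * D₀ + 1) ^ I.card * (t * D₁ + 1) ^ Jc.card ≤ hilb D₀ D₁ (H₀ : Set (LinGroup d₀ d₁)) t := by
  classical
  haveI := hirr.isPrime
  set 𝔭 := vanishing (H₀ : Set (LinGroup d₀ d₁)) with h𝔭
  -- the index set and the monomials
  let Ix := (↥I → Fin (t * D₀ + 1)) × (↥Jc → Fin (t * D₁ + 1))
  set fam : Ix → MvPolynomial (Fin d₀ ⊕ Fin d₁) ℂ := fun ic => monomial (boxExp I Jc ic) 1 with hfam
  have hcardI : Fintype.card Ix = (t * D₀ + 1) ^ I.card * (t * D₁ + 1) ^ Jc.card := by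
    simp only [Ix, Fintype.card_prod, Fintype.card_pi, Fintype.card_fin, Finset.prod_const, Finset.card_univ,
      Fintype.card_coe]
  -- they lie in the box
  have hfamBox : ∀ ic, fam ic ∈ Box (d₀ := d₀) (d₁ := d₁) D₀ D₁ t := by
    intro ic
    rw [hfam]
    refine (monomial_mem_restrictSupport ℂ).mpr (Or.inl fun v => ?_)
    rcases v with i | l
    · rw [boxExp_inl, bd_inl]
      split_ifs with h
      · have := (ic.1 ⟨i, h⟩).2; omega
      · exact Nat.zero_le _
    · rw [boxExp_inr, bd_inr]
      split_ifs with h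
      · have := (ic.2 ⟨l, h⟩).2; omega
      · exact Nat.zero_le _
  -- they are linearly independent
  have hfamli : LinearIndependent ℂ fam := by
    have h := (MvPolynomial.basisMonomials (Fin d₀ ⊕ Fin d₁) ℂ).linearIndependent.comp (boxExp I Jc)
      (boxExp_injective I Jc (T₀ := t * D₀ + 1) (T := t * D₁ + 1))
    have he : (⇑(MvPolynomial.basisMonomials (Fin d₀ ⊕ Fin d₁) ℂ) ∘ boxExp I Jc) = fam := by
      funext ic
      simp [hfam, MvPolynomial.coe_basisMonomials]
    rw [he] at h
    exact h
  -- the torus points of `H₀`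
  let Hs : Subgroup (LinGroup d₀ d₁) :=
    { carrier := {h | h ∈ H₀ ∧ h.1 = 1}
      one_mem' := ⟨H₀.one_mem, rfl⟩
      mul_mem' := fun {u v} hu hv => ⟨H₀.mul_mem hu.1 hv.1, by rw [Prod.fst_mul, hu.2, hv.2, one_mul]⟩
      inv_mem' := fun {u} hu => ⟨H₀.inv_mem hu.1, by rw [Prod.fst_inv, hu.2, inv_one]⟩ }
  have hHs_char : charGroup ((Hs : Subgroup (LinGroup d₀ d₁)) : Set (LinGroup d₀ d₁)) = charGroup (H₀ : Set (LinGroup d₀ d₁)) := by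
    ext χ
    simp only [mem_charGroup_iff]
    constructor
    · intro h k hk
      exact h ((1 : Multiplicative (Fin d₀ → ℂ)), k.2) ⟨torusPart_mem H₀ hirr.isClosedG hk, rfl⟩
    · intro h k hk
      exact h k hk.1
  -- for fixed `α`, the characters `c ↦ y^{boxExp (α, c)}` of `Hs` are pairwise distinct
  have hinj : ∀ α : ↥I → Fin (t * D₀ + 1),
      Function.Injective (fun c : ↥Jc → Fin (t * D₁ + 1) => monChar Hs (boxExp I Jc (α, c))) := by
    intro α c c' hcc
    have hv := sub_mem_charGroup_of_monChar_eq hcc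
    rw [hHs_char] at hv
    set v : Fin d₁ → ℤ := fun j => (boxExp I Jc (α, c') (Sum.inr j) : ℤ) - boxExp I Jc (α, c) (Sum.inr j) with hvdef
    -- `v` is supported on `Jc`
    have hv0 : ∀ l, l ∉ Jc → v l = 0 := fun l hl => by
      simp [hvdef, boxExp_inr, hl]
    -- `castC v` is a rational combination of the `χᵢ`
    obtain ⟨q, hq⟩ := (Submodule.mem_span_range_iff_exists_fun ℚ).mp (hspan v hv)
    have hC : ∑ i, ((q i : ℂ) • GaGm.castC (b i)) = GaGm.castC v := by
      have := congrArg GaGm.castQC hq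
      rw [map_sum, GaGm.castQC_castQ] at this
      rw [← this]
      refine Finset.sum_congr rfl fun i _ => ?_
      rw [map_smul, GaGm.castQC_castQ, ← algebraMap_smul ℂ (q i) (GaGm.castC (b i))]
      simp [eq_ratCast]
    -- and a combination of the unit vectors `e_j`, `j ∈ Jc`
    have hE : ∑ j : ↥Jc, ((v j : ℂ) • (Pi.single (j : Fin d₁) (1 : ℂ) : Fin d₁ → ℂ)) = GaGm.castC v := by
      funext l
      simp only [Finset.sum_apply, Pi.smul_apply, smul_eq_mul, GaGm.castC]
      by_cases hl : l ∈ Jc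
      · rw [Finset.sum_eq_single (⟨l, hl⟩ : ↥Jc)]
        · simp
        · intro j _ hj
          have : (l : Fin d₁) ≠ j := fun h => hj (Subtype.ext h.symm)
          rw [Pi.single_eq_of_ne this, mul_zero]
        · intro h; exact absurd (Finset.mem_univ _) h
      · rw [hv0 l hl, Int.cast_zero]
        refine Finset.sum_eq_zero fun j _ => ?_
        have : (l : Fin d₁) ≠ j := fun h => hl (h ▸ j.2)
        rw [Pi.single_eq_of_ne this, mul_zero]
    -- independence forces `v = 0` on `Jc`
    let g : Fin r ⊕ ↥Jc → ℂ := Sum.elim (fun i => (q i : ℂ)) (fun j => -(v j : ℂ))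
    have hrel : ∑ x, g x • Sum.elim (fun i => GaGm.castC (b i)) (fun j : ↥Jc => (Pi.single (j : Fin d₁) (1 : ℂ) : Fin d₁ → ℂ)) x = 0 := by
      rw [Fintype.sum_sum_type]
      simp only [g, Sum.elim_inl, Sum.elim_inr, neg_smul, Finset.sum_neg_distrib]
      rw [hC, hE, add_neg_cancel]
    have hzero := Fintype.linearIndependent_iff.mp hli g hrel
    funext j
    apply Fin.ext
    have hj : -(v j : ℂ) = 0 := hzero (Sum.inr j)
    rw [neg_eq_zero, Int.cast_eq_zero, hvdef] at hj
    have hj' : (boxExp I Jc (α, c') (Sum.inr (j : Fin d₁)) : ℤ) = boxExp I Jc (α, c) (Sum.inr (j : Fin d₁)) := by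
      have := hj; simp only at this; linarith
    have hj'' : boxExp I Jc (α, c') (Sum.inr (j : Fin d₁)) = boxExp I Jc (α, c) (Sum.inr (j : Fin d₁)) := by
      exact_mod_cast hj'
    rw [boxExp_inr, boxExp_inr, dif_pos j.2, dif_pos j.2] at hj''
    exact hj''.symm
  -- their span meets `𝔭` trivially
  have hinf : Submodule.span ℂ (Set.range fam) ⊓ 𝔭.restrictScalars ℂ = ⊥ := by
    rw [Submodule.eq_bot_iff]
    rintro Q ⟨hQ, hQ𝔭⟩
    rw [SetLike.mem_coe, Submodule.mem_span_range_iff_exists_fun] at hQ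
    obtain ⟨cf, rfl⟩ := hQ
    -- the value at `(x, y)`
    have hval : ∀ (x : Fin d₀ → ℂ) (y : Fin d₁ → ℂˣ),
        evalAt (∑ ic, cf ic • fam ic) (Multiplicative.ofAdd x, y) =
          ∑ α : ↥I → Fin (t * D₀ + 1), (∑ c : ↥Jc → Fin (t * D₁ + 1), cf (α, c) * charVal y (boxExp I Jc (α, c))) *
            ∏ i : ↥I, x i ^ ((α i : Fin (t * D₀ + 1)) : ℕ) := by
      intro x y
      rw [evalAt_eq_eval, map_sum, Fintype.sum_prod_type]
      refine Finset.sum_congr rfl fun α _ => ?_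
      rw [Finset.sum_mul]
      refine Finset.sum_congr rfl fun c _ => ?_
      rw [hfam]
      dsimp only
      rw [MvPolynomial.smul_eval, ← evalAt_eq_eval, evalAt_monomial, addVal_boxExp]
      simp only [toAdd_ofAdd, one_mul]
      ring
    -- Step 1: for every torus point `y` of `H₀` and every `α`, `∑_c cf(α,c) y^{c} = 0`
    have step1 : ∀ y : Fin d₁ → ℂˣ, ((1 : Multiplicative (Fin d₀ → ℂ)), y) ∈ H₀ → ∀ α : ↥I → Fin (t * D₀ + 1),
        ∑ c : ↥Jc → Fin (t * D₁ + 1), cf (α, c) * charVal y (boxExp I Jc (α, c)) = 0 := by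
      intro y hy
      set coef : (↥I → Fin (t * D₀ + 1)) → ℂ := fun α =>
        ∑ c : ↥Jc → Fin (t * D₁ + 1), cf (α, c) * charVal y (boxExp I Jc (α, c)) with hcoef
      -- the polynomial in the `I`-variables
      set Pol : MvPolynomial ↥I ℂ := ∑ α, monomial (expI I α) (coef α) with hPol
      have hPev : ∀ z : ↥I → ℂ, MvPolynomial.eval z Pol = ∑ α, coef α * ∏ i : ↥I, z i ^ ((α i : Fin (t * D₀ + 1)) : ℕ) := by
        intro z
        rw [hPol, map_sum]
        refine Finset.sum_congr rfl fun α _ => ?_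
        rw [MvPolynomial.eval_monomial, Finsupp.prod_fintype _ _ (fun i => by simp)]
        simp [expI]
      have hPcoeff : ∀ α, Pol.coeff (expI I α) = coef α := by
        intro α
        rw [hPol, MvPolynomial.coeff_sum]
        simp only [MvPolynomial.coeff_monomial]
        rw [Finset.sum_eq_single α]
        · rw [if_pos rfl]
        · intro α' _ hα'
          rw [if_neg]
          exact fun h => hα' (expI_injective I h)
        · intro h; exact absurd (Finset.mem_univ _) h
      -- `Pol = 0`: it vanishes on `ℂ^I` since `E → ℂ^I` is onto and `Q` vanishes on `E × {y}`
      have hP0 : Pol = 0 := by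
        apply MvPolynomial.funext
        intro z
        rw [map_zero, hPev]
        obtain ⟨x, hxE, hxz⟩ := hI (fun i => if h : i ∈ I then z ⟨i, h⟩ else 0)
        have hxz' : ∀ i : ↥I, x i = z i := fun i => by
          rw [hxz i i.2, dif_pos i.2]
        have h0 := hQ𝔭 _ (mem_of_mem_addSubspace H₀ hirr.isClosedG hxE hy)
        rw [hval x y] at h0
        rw [← h0]
        refine Finset.sum_congr rfl fun α _ => ?_
        rw [hcoef]
        simp only [hxz']
      intro α
      change coef α = 0
      rw [← hPcoeff α, hP0, MvPolynomial.coeff_zero]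
    -- Step 2: Artin
    have hcf : ∀ ic, cf ic = 0 := by
      rintro ⟨α, c⟩
      have hliφ := (linearIndependent_monoidHom (↥Hs) ℂ).comp _ (hinj α)
      have h0 := Fintype.linearIndependent_iff.mp hliφ (fun c => cf (α, c)) (by
        funext k
        simp only [Function.comp_apply, Finset.sum_apply, Pi.smul_apply, smul_eq_mul, Pi.zero_apply,
          monChar_apply]
        have hk : ((1 : Multiplicative (Fin d₀ → ℂ)), (k : LinGroup d₀ d₁).2) ∈ H₀ := by
          have : ((1 : Multiplicative (Fin d₀ → ℂ)), (k : LinGroup d₀ d₁).2) = (k : LinGroup d₀ d₁) := by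
            ext <;> simp [k.2.2]
          rw [this]; exact k.2.1
        exact step1 _ hk α)
      exact h0 c
    simp [hcf]
  -- conclusion: `span fam ⊕ (Box ⊓ 𝔭) ≤ Box`
  set W := Submodule.span ℂ (Set.range fam) with hW
  have hWle : W ≤ Box (d₀ := d₀) (d₁ := d₁) D₀ D₁ t := Submodule.span_le.mpr (by rintro _ ⟨ic, rfl⟩; exact hfamBox ic)
  have hWfin : finrank ℂ ↥W = Fintype.card Ix := finrank_span_eq_card hfamli
  haveI : FiniteDimensional ℂ ↥W := FiniteDimensional.span_of_finite ℂ (Set.finite_range fam)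
  haveI : FiniteDimensional ℂ ↥(Box (d₀ := d₀) (d₁ := d₁) D₀ D₁ t ⊓ 𝔭.restrictScalars ℂ) :=
    Submodule.finiteDimensional_inf_left _ _
  have h1 := Submodule.finrank_sup_add_finrank_inf_eq W (Box (d₀ := d₀) (d₁ := d₁) D₀ D₁ t ⊓ 𝔭.restrictScalars ℂ)
  have h2 : W ⊓ (Box (d₀ := d₀) (d₁ := d₁) D₀ D₁ t ⊓ 𝔭.restrictScalars ℂ) = ⊥ := by
    rw [eq_bot_iff, ← hinf]
    exact le_inf inf_le_left (inf_le_right.trans inf_le_right)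
  rw [h2, finrank_bot, add_zero] at h1
  have h3 : finrank ℂ ↥(W ⊔ (Box (d₀ := d₀) (d₁ := d₁) D₀ D₁ t ⊓ 𝔭.restrictScalars ℂ)) ≤
      finrank ℂ ↥(Box (d₀ := d₀) (d₁ := d₁) D₀ D₁ t) :=
    Submodule.finrank_mono (sup_le hWle inf_le_left)
  have h4 := hilbI_add_finrank_inf (d₀ := d₀) (d₁ := d₁) (D₀ := D₀) (D₁ := D₁) (𝔭.restrictScalars ℂ) t
  rw [← hcardI, ← hWfin]
  change _ ≤ hilbI D₀ D₁ (𝔭.restrictScalars ℂ) t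
  omega

/-! ### Dimension and multiplicity of a connected subgroup -/

open Filter Topology in
/-- **Dimension and degree of a connected subgroup.** For an irreducible closed subgroup
`H₀ = E × T_A`: `dim H₀ = dim E + dim T_A` and `mult_{D₀,D₁}(H₀) ≥ D₀^{dim E} D₁^{dim T_A}`
(LNM 1752, Ch. 11, the computation behind Thm 4.1's `ℋ`; Philippon 1986, Prop. 3.3 & §4;
Waldschmidt 1988, §7 "`H(G'; D₀, D₁)`"). [folklore] -/
theorem dimG_eq_and_pow_le_mult {D₀ D₁ : ℕ} (hD₀ : 1 ≤ D₀) (hD₁ : 1 ≤ D₁) (H₀ : Subgroup (LinGroup d₀ d₁))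
    (hirr : IsIrred (H₀ : Set (LinGroup d₀ d₁))) :
    dimG (H₀ : Set (LinGroup d₀ d₁)) = (toConnAlgSubgroup H₀ hirr).addDim + (toConnAlgSubgroup H₀ hirr).torusDim ∧
      D₀ ^ (toConnAlgSubgroup H₀ hirr).addDim * D₁ ^ (toConnAlgSubgroup H₀ hirr).torusDim ≤
        mult D₀ D₁ (H₀ : Set (LinGroup d₀ d₁)) := by
  classical
  set 𝓗 := toConnAlgSubgroup H₀ hirr with h𝓗
  obtain ⟨r, b, Jc, hbA, hcard, hli, hspan, hrel⟩ := GaGm.exists_latticeData (charGroup (H₀ : Set (LinGroup d₀ d₁)))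
  obtain ⟨I, hIcard, hIcomb, hIonto⟩ := exists_coordData (addSubspace H₀ hirr.isClosedG)
  -- torus dimension
  have htor : 𝓗.torusDim = Jc.card := by
    rw [ConnAlgSubgroup.torusDim, torusTangent_eq_tangentOf, h𝓗, toConnAlgSubgroup_chars]
    exact GaGm.finrank_tangentOf hbA hcard hli hspan
  -- additive dimension
  have hadd : 𝓗.addDim = I.card := by
    rw [ConnAlgSubgroup.addDim, h𝓗, toConnAlgSubgroup_addPart, hIcard]
  rw [htor, hadd]
  set δ₀ := I.card with hδ₀
  set m := dimG (H₀ : Set (LinGroup d₀ d₁)) with hm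
  -- upper bound
  have hup : m ≤ δ₀ + Jc.card := dimG_le_card_add_card H₀ hirr hIcomb hbA hrel
  -- lower bound for the Hilbert function
  have hlow : ∀ t, D₀ ^ δ₀ * D₁ ^ Jc.card * t ^ (δ₀ + Jc.card) ≤ hilb D₀ D₁ (H₀ : Set (LinGroup d₀ d₁)) t := by
    intro t
    refine le_trans ?_ (pow_mul_pow_le_hilb D₀ D₁ H₀ hirr hIonto hli hspan t)
    calc D₀ ^ δ₀ * D₁ ^ Jc.card * t ^ (δ₀ + Jc.card) = (t * D₀) ^ δ₀ * (t * D₁) ^ Jc.card := by ring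
      _ ≤ (t * D₀ + 1) ^ δ₀ * (t * D₁ + 1) ^ Jc.card :=
        Nat.mul_le_mul (Nat.pow_le_pow_left (Nat.le_succ _) _) (Nat.pow_le_pow_left (Nat.le_succ _) _)
  -- the multiplicity and the limit
  obtain ⟨hHM, hmult1⟩ := hirr.hasMult (D₀ := D₀) (D₁ := D₁) hD₀ hD₁
  have hlim := hHM.tendsto
  rw [← hm] at hlim
  set M := mult D₀ D₁ (H₀ : Set (LinGroup d₀ d₁)) with hM
  set c : ℕ := D₀ ^ δ₀ * D₁ ^ Jc.card with hc
  have hc1 : 1 ≤ c := Nat.mul_pos (Nat.pow_pos hD₀) (Nat.pow_pos hD₁)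
  -- `f t ≥ m! c t^{δ₀ + k - m}`
  have hf : ∀ t : ℕ, 1 ≤ t → ((m.factorial * c * t ^ (δ₀ + Jc.card - m) : ℕ) : ℝ) ≤
      ((m.factorial * hilb D₀ D₁ (H₀ : Set (LinGroup d₀ d₁)) t : ℕ) : ℝ) / (t : ℝ) ^ m := by
    intro t ht
    have htpos : (0 : ℝ) < (t : ℝ) ^ m := by positivity
    rw [le_div_iff₀ htpos]
    have h1 := hlow t
    have h2 : m.factorial * c * t ^ (δ₀ + Jc.card - m) * t ^ m = m.factorial * (c * t ^ (δ₀ + Jc.card)) := by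
      rw [mul_assoc, mul_assoc, ← pow_add, Nat.sub_add_cancel hup]
    exact_mod_cast (show m.factorial * c * t ^ (δ₀ + Jc.card - m) * t ^ m ≤
        m.factorial * hilb D₀ D₁ (H₀ : Set (LinGroup d₀ d₁)) t by
      rw [h2]; exact Nat.mul_le_mul_left _ h1)
  -- hence `δ₀ + k ≤ m`
  have hle : δ₀ + Jc.card ≤ m := by
    by_contra hlt
    push Not at hlt
    have h := GaGm.eq_zero_of_tendsto_of_mul_le hlim (c := m.factorial * c) (fun t ht => by
      refine le_trans ?_ (hf t ht)
      have : t ≤ t ^ (δ₀ + Jc.card - m) := by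
        calc t = t ^ 1 := (pow_one t).symm
          _ ≤ t ^ (δ₀ + Jc.card - m) := Nat.pow_le_pow_right ht (by omega)
      exact_mod_cast Nat.mul_le_mul_left _ this)
    have : 1 ≤ m.factorial * c := Nat.mul_pos (Nat.factorial_pos _) hc1
    omega
  have hmeq : m = δ₀ + Jc.card := le_antisymm hup hle
  refine ⟨hmeq, ?_⟩
  -- and `c ≤ M` by passing to the limit
  have hev : ∀ t : ℕ, 1 ≤ t → ((m.factorial * c : ℕ) : ℝ) ≤
      ((m.factorial * hilb D₀ D₁ (H₀ : Set (LinGroup d₀ d₁)) t : ℕ) : ℝ) / (t : ℝ) ^ m := by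
    intro t ht
    have := hf t ht
    rwa [hmeq, Nat.sub_self, pow_zero, mul_one, ← hmeq] at this
  have hge : ((m.factorial * c : ℕ) : ℝ) ≤ (M : ℝ) :=
    ge_of_tendsto hlim (Filter.eventually_atTop.mpr ⟨1, hev⟩)
  have hge' : m.factorial * c ≤ M := by exact_mod_cast hge
  exact le_trans (Nat.le_mul_of_pos_left _ (Nat.factorial_pos _)) hge'

/-- `dim H₀ = dim E + dim T_A`. [folklore] -/
theorem dimG_eq_addDim_add_torusDim (H₀ : Subgroup (LinGroup d₀ d₁)) (hirr : IsIrred (H₀ : Set (LinGroup d₀ d₁))) :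
    dimG (H₀ : Set (LinGroup d₀ d₁)) = (toConnAlgSubgroup H₀ hirr).addDim + (toConnAlgSubgroup H₀ hirr).torusDim :=
  (dimG_eq_and_pow_le_mult le_rfl le_rfl H₀ hirr).1

/-- **`mult_{D₀,D₁}(H₀) ≥ D₀^{dim E} D₁^{dim T_A}`.** [folklore] -/
theorem pow_le_mult {D₀ D₁ : ℕ} (hD₀ : 1 ≤ D₀) (hD₁ : 1 ≤ D₁) (H₀ : Subgroup (LinGroup d₀ d₁))
    (hirr : IsIrred (H₀ : Set (LinGroup d₀ d₁))) :
    D₀ ^ (toConnAlgSubgroup H₀ hirr).addDim * D₁ ^ (toConnAlgSubgroup H₀ hirr).torusDim ≤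
      mult D₀ D₁ (H₀ : Set (LinGroup d₀ d₁)) :=
  (dimG_eq_and_pow_le_mult hD₀ hD₁ H₀ hirr).2

end LinGroup

end Literature.NumberTheory.Transcendental

noncomputable section

open MvPolynomial
open scoped Pointwise

namespace Literature.NumberTheory.Transcendental

namespace LinGroup

variable {d₀ d₁ : ℕ}

namespace Descent

/-! ### Sumsets -/

/-- `e ∈ Σ(r)` when `e ∈ Σ`. [folklore] -/
theorem one_mem_sumset {S : Set (LinGroup d₀ d₁)} (h1 : (1 : LinGroup d₀ d₁) ∈ S) (r : ℕ) : (1 : LinGroup d₀ d₁) ∈ sumset S r :=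
  ⟨fun _ => 1, fun _ => h1, by simp⟩

/-- `Σ(r) · Σ ⊆ Σ(r+1)`. [folklore] -/
theorem mul_mem_sumset_succ {S : Set (LinGroup d₀ d₁)} {r : ℕ} {γ σ : LinGroup d₀ d₁} (hγ : γ ∈ sumset S r)
    (hσ : σ ∈ S) : γ * σ ∈ sumset S (r + 1) := by
  obtain ⟨τ, hτ, rfl⟩ := hγ
  refine ⟨Fin.snoc τ σ, fun i => ?_, ?_⟩
  · refine Fin.lastCases ?_ (fun j => ?_) i
    · simpa using hσ
    · simpa using hτ j
  · rw [Fin.prod_univ_castSucc]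
    simp

/-- `Σ(r) ⊆ Σ(r+1)` when `e ∈ Σ`. [folklore] -/
theorem sumset_subset_succ {S : Set (LinGroup d₀ d₁)} (h1 : (1 : LinGroup d₀ d₁) ∈ S) (r : ℕ) :
    sumset S r ⊆ sumset S (r + 1) := fun γ hγ => by
  simpa using mul_mem_sumset_succ hγ h1

/-! ### The chain of zero sets `Z_r = {g ; P(γ g) = 0 ∀ γ ∈ Σ(r)}` -/

/-- The translates `P(γ ·)`, `γ ∈ Σ(r)`. [folklore] -/
def gens (S : Set (LinGroup d₀ d₁)) (P : MvPolynomial (Fin d₀ ⊕ Fin d₁) ℂ) (r : ℕ) : Set (MvPolynomial (Fin d₀ ⊕ Fin d₁) ℂ) :=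
  (fun γ => shift γ P) '' sumset S r

/-- The zero sets `Z_r` of Philippon's ideals `I_{r+1}` at `T = 0`. [folklore] -/
def Zs (S : Set (LinGroup d₀ d₁)) (P : MvPolynomial (Fin d₀ ⊕ Fin d₁) ℂ) (r : ℕ) : Set (LinGroup d₀ d₁) :=
  zeroSet (gens S P r)

/-- The generators are box polynomials. [folklore] -/
theorem gens_subset_Box {D₀ D₁ : ℕ} {S : Set (LinGroup d₀ d₁)} {P : MvPolynomial (Fin d₀ ⊕ Fin d₁) ℂ}
    (hP : P ∈ Box (d₀ := d₀) (d₁ := d₁) D₀ D₁ 1) (r : ℕ) : gens S P r ⊆ Box (d₀ := d₀) (d₁ := d₁) D₀ D₁ 1 := by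
  rintro _ ⟨γ, -, rfl⟩
  exact shift_mem_Box γ hP

/-- Membership in `Z_r`. [folklore] -/
theorem mem_Zs_iff {S : Set (LinGroup d₀ d₁)} {P : MvPolynomial (Fin d₀ ⊕ Fin d₁) ℂ} {r : ℕ} {g : LinGroup d₀ d₁} :
    g ∈ Zs S P r ↔ ∀ γ ∈ sumset S r, evalAt P (γ * g) = 0 := by
  simp only [Zs, gens, mem_zeroSet_iff, Set.forall_mem_image, evalAt_shift]

/-- `Z_r` is closed. [folklore] -/
theorem isClosedG_Zs (S : Set (LinGroup d₀ d₁)) (P : MvPolynomial (Fin d₀ ⊕ Fin d₁) ℂ) (r : ℕ) : IsClosedG (Zs S P r) :=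
  isClosedG_zeroSet _

/-- `Z_{r+1} ⊆ Z_r`. [folklore] -/
theorem Zs_succ_subset {S : Set (LinGroup d₀ d₁)} (h1 : (1 : LinGroup d₀ d₁) ∈ S) (P : MvPolynomial (Fin d₀ ⊕ Fin d₁) ℂ) (r : ℕ) :
    Zs S P (r + 1) ⊆ Zs S P r := fun g hg => by
  rw [mem_Zs_iff] at hg ⊢
  exact fun γ hγ => hg γ (sumset_subset_succ h1 r hγ)

/-- `Z_{r'} ⊆ Z_r` for `r ≤ r'`. [folklore] -/
theorem Zs_antitone {S : Set (LinGroup d₀ d₁)} (h1 : (1 : LinGroup d₀ d₁) ∈ S) (P : MvPolynomial (Fin d₀ ⊕ Fin d₁) ℂ) {r r' : ℕ}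
    (h : r ≤ r') : Zs S P r' ⊆ Zs S P r := by
  induction h with
  | refl => exact le_rfl
  | step _ ih => exact (Zs_succ_subset h1 P _).trans ih

/-- **`σ Z_{r+1} ⊆ Z_r` for `σ ∈ Σ`.** [folklore] -/
theorem smul_Zs_succ_subset {S : Set (LinGroup d₀ d₁)} {σ : LinGroup d₀ d₁} (hσ : σ ∈ S) (P : MvPolynomial (Fin d₀ ⊕ Fin d₁) ℂ)
    (r : ℕ) : σ • Zs S P (r + 1) ⊆ Zs S P r := by
  rintro _ ⟨g, hg, rfl⟩
  dsimp only
  rw [mem_Zs_iff] at hg ⊢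
  intro γ hγ
  rw [smul_eq_mul, ← mul_assoc]
  exact hg _ (mul_mem_sumset_succ hγ hσ)

/-- `e ∈ Z_r` when `P` vanishes on `Σ(r)`. [folklore] -/
theorem one_mem_Zs {S : Set (LinGroup d₀ d₁)} {P : MvPolynomial (Fin d₀ ⊕ Fin d₁) ℂ} {r : ℕ}
    (hvan : ∀ g ∈ sumset S r, evalAt P g = 0) : (1 : LinGroup d₀ d₁) ∈ Zs S P r := by
  rw [mem_Zs_iff]
  intro γ hγ
  rw [mul_one]; exact hvan γ hγ

/-- `Z_0 = Z(P)`. [folklore] -/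
theorem mem_Zs_zero_iff {S : Set (LinGroup d₀ d₁)} {P : MvPolynomial (Fin d₀ ⊕ Fin d₁) ℂ} {g : LinGroup d₀ d₁} :
    g ∈ Zs S P 0 ↔ evalAt P g = 0 := by
  rw [mem_Zs_iff, sumset_zero]
  simp

/-! ### The stabiliser of an irreducible closed set -/

/-- `gV ⊆ V` forces `gV = V` for irreducible closed `V`. [folklore] -/
theorem smul_eq_of_smul_subset {V : Set (LinGroup d₀ d₁)} (hV : IsIrred V) {g : LinGroup d₀ d₁} (h : g • V ⊆ V) : g • V = V :=
  hV.eq_of_subset_of_dimG_eq (hV.smul g).isClosedG (hV.nonempty.smul_set) h (dimG_smul g V)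

/-- `gV ⊆ V` already puts `g` in the stabiliser `MulAction.stabilizer G V = {g ; gV = V}` of an
irreducible closed `V`. [folklore] -/
theorem mem_stabilizer_of_smul_subset {V : Set (LinGroup d₀ d₁)} (hV : IsIrred V) {g : LinGroup d₀ d₁} (h : g • V ⊆ V) :
    g ∈ MulAction.stabilizer (LinGroup d₀ d₁) V :=
  MulAction.mem_stabilizer_iff.mpr (smul_eq_of_smul_subset hV h)

/-- The stabiliser of an irreducible closed `V` is the zero set of the translates `f(v ·)`, `v ∈ V`,
`f ∈ 𝔍(V)`. [folklore] -/
theorem coe_stabilizer_eq_zeroSet {V : Set (LinGroup d₀ d₁)} (hV : IsIrred V) :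
    ((MulAction.stabilizer (LinGroup d₀ d₁) V : Subgroup (LinGroup d₀ d₁)) : Set (LinGroup d₀ d₁)) =
      zeroSet (Set.image2 (fun v f => shift v f) V (vanishing V : Set (MvPolynomial (Fin d₀ ⊕ Fin d₁) ℂ))) := by
  ext g
  rw [SetLike.mem_coe, MulAction.mem_stabilizer_iff]
  simp only [mem_zeroSet_iff, Set.forall_mem_image2, evalAt_shift]
  constructor
  · intro h v hv f hf
    exact hf (v * g) (h.le ⟨v, hv, by dsimp only; rw [smul_eq_mul, mul_comm]⟩)
  · intro h
    refine smul_eq_of_smul_subset hV ?_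
    rintro _ ⟨v, hv, rfl⟩
    dsimp only
    rw [← hV.isClosedG.eq]
    intro f hf
    rw [smul_eq_mul, mul_comm]
    exact h v hv f hf

/-- The stabiliser of an irreducible closed set is closed. [folklore] -/
theorem isClosedG_stabilizer {V : Set (LinGroup d₀ d₁)} (hV : IsIrred V) :
    IsClosedG ((MulAction.stabilizer (LinGroup d₀ d₁) V : Subgroup (LinGroup d₀ d₁)) : Set (LinGroup d₀ d₁)) := by
  rw [coe_stabilizer_eq_zeroSet hV]; exact isClosedG_zeroSet _

/-! ### The transporter `E = {g ; gV ⊆ Z}` -/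

/-- The translates `f(v ·)`, `v ∈ V`, `f ∈ F`: generators of the transporter of `V` into `Z(F)`.
[folklore] -/
def transGens (V : Set (LinGroup d₀ d₁)) (F : Set (MvPolynomial (Fin d₀ ⊕ Fin d₁) ℂ)) : Set (MvPolynomial (Fin d₀ ⊕ Fin d₁) ℂ) :=
  Set.image2 (fun v f => shift v f) V F

/-- The generators of the transporter are box polynomials if `F` is. [folklore] -/
theorem transGens_subset_Box {D₀ D₁ : ℕ} {V : Set (LinGroup d₀ d₁)} {F : Set (MvPolynomial (Fin d₀ ⊕ Fin d₁) ℂ)}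
    (hF : F ⊆ Box (d₀ := d₀) (d₁ := d₁) D₀ D₁ 1) : transGens V F ⊆ Box (d₀ := d₀) (d₁ := d₁) D₀ D₁ 1 := by
  rintro _ ⟨v, -, f, hf, rfl⟩
  exact shift_mem_Box v (hF hf)

/-- Membership in the transporter `Z(transGens V F) = {g ; gV ⊆ Z(F)}`. [folklore] -/
theorem mem_zeroSet_transGens_iff {V : Set (LinGroup d₀ d₁)} {F : Set (MvPolynomial (Fin d₀ ⊕ Fin d₁) ℂ)} {g : LinGroup d₀ d₁} :
    g ∈ zeroSet (transGens V F) ↔ g • V ⊆ zeroSet (d₀ := d₀) (d₁ := d₁) F := by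
  simp only [transGens, mem_zeroSet_iff, Set.forall_mem_image2, evalAt_shift]
  constructor
  · intro h
    rintro _ ⟨v, hv, rfl⟩ f hf
    dsimp only
    rw [smul_eq_mul, mul_comm]
    exact h v hv f hf
  · intro h v hv f hf
    rw [mul_comm]
    exact h ⟨v, hv, rfl⟩ f hf

end Descent

/-! ### The descent -/

/-- **Philippon's descent at `T = 0` on `𝔾ₐ^{d₀} × 𝔾ₘ^{d₁}`** (Philippon 1986, §5 with Prop. 3.3 and
Lemme 4.5, case `G = 𝔾ₐ^{d₀} × 𝔾ₘ^{d₁} ⊂ (ℙ¹)^{d}`, `d = d₀ + d₁`, `cᵢ = 1`, `T = 0`). Let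
`D₀, D₁ ≥ 1`, `Σ ⊆ G(ℂ)` finite with `e ∈ Σ`, and `P ≠ 0` a box polynomial of box degrees
`(D₀, D₁)` vanishing on `Σ(d)`. Then there is an irreducible closed subgroup `H₀` of
`G(ℂ) = ℂ^{d₀} × (ℂˣ)^{d₁}` which is a component of the zero set of a family of box polynomials of
box degrees `(D₀, D₁)`, is contained in a translate of `Z(P)`, and satisfies
`card((Σ·H₀)/H₀) · mult_{D₀,D₁}(H₀) ≤ d! D₀^{d₀} D₁^{d₁}` (we count, as in the
printed theorem, the classes of `Σ` itself; the proof bounds the number of all the cosets of `H₀`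
inside the transporter `E ⊇ Σ`, Philippon's `card S ≥ card((Σ + G_V)/G_V)`, p. 381 (∗∗∗)).
[cite: Philippon1986, Thm 2.1 (p. 358) and §5 (pp. 380–383), case T = 0, G = 𝔾ₐ^{d₀} × 𝔾ₘ^{d₁} ⊂ (ℙ¹)^{d₀+d₁}] -/
theorem exists_obstruction_subgroup {D₀ D₁ : ℕ} (hD₀ : 1 ≤ D₀) (hD₁ : 1 ≤ D₁) {S : Set (LinGroup d₀ d₁)}
    (hS : S.Finite) (h1 : (1 : LinGroup d₀ d₁) ∈ S) {P : MvPolynomial (Fin d₀ ⊕ Fin d₁) ℂ} (hP0 : P ≠ 0)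
    (hPB : P ∈ Box (d₀ := d₀) (d₁ := d₁) D₀ D₁ 1) (hvan : ∀ g ∈ sumset S (d₀ + d₁), evalAt P g = 0) :
    ∃ (H₀ : Subgroup (LinGroup d₀ d₁)) (_ : IsIrred (H₀ : Set (LinGroup d₀ d₁))),
      (∃ (F : Set (MvPolynomial (Fin d₀ ⊕ Fin d₁) ℂ)) (𝔮 : Ideal (MvPolynomial (Fin d₀ ⊕ Fin d₁) ℂ)),
        F ⊆ Box (d₀ := d₀) (d₁ := d₁) D₀ D₁ 1 ∧ 𝔮 ∈ comps (zeroSet (d₀ := d₀) (d₁ := d₁) F) ∧ (H₀ : Set (LinGroup d₀ d₁)) = zeroSetI 𝔮) ∧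
      (∃ g : LinGroup d₀ d₁, ∀ h ∈ H₀, evalAt P (g * h) = 0) ∧
      Set.ncard ((QuotientGroup.mk : LinGroup d₀ d₁ → LinGroup d₀ d₁ ⧸ H₀) '' S) * mult D₀ D₁ (H₀ : Set (LinGroup d₀ d₁)) ≤
        (d₀ + d₁).factorial * D₀ ^ d₀ * D₁ ^ d₁ := by
  classical
  -- the chain `Z_r`
  have hZcl : ∀ r, IsClosedG (Descent.Zs S P r) := Descent.isClosedG_Zs S P
  have h1Z : ∀ r, r ≤ d₀ + d₁ → (1 : LinGroup d₀ d₁) ∈ Descent.Zs S P r := fun r hr =>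
    Descent.Zs_antitone h1 P hr (Descent.one_mem_Zs hvan)
  have hZne : ∀ r, r ≤ d₀ + d₁ → (Descent.Zs S P r).Nonempty := fun r hr => ⟨1, h1Z r hr⟩
  -- `dim Z_0 ≤ d₀ + d₁ - 1`
  have hd0 : dimG (Descent.Zs S P 0) ≤ d₀ + d₁ - 1 ∧ 1 ≤ d₀ + d₁ := by
    have hne : Descent.Zs S P 0 ≠ Set.univ := by
      intro h
      apply hP0
      have : P ∈ vanishing (Set.univ : Set (LinGroup d₀ d₁)) := fun g _ => by
        have hg : g ∈ Descent.Zs S P 0 := h ▸ Set.mem_univ g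
        exact Descent.mem_Zs_zero_iff.mp hg
      rwa [vanishing_univ, Submodule.mem_bot] at this
    have hlt := dimG_lt_of_ssubset isIrred_univ (hZcl 0) (hZne 0 (Nat.zero_le _))
      (Set.ssubset_univ_iff.mpr hne)
    rw [dimG_univ] at hlt
    omega
  obtain ⟨hd0, hpos⟩ := hd0
  -- pigeonhole: `dim Z_r = dim Z_{r+1}`
  obtain ⟨r, hrn, hdr⟩ := GaGm.Descent.exists_eq_succ_of_antitone (d := fun r => dimG (Descent.Zs S P r))
    (fun r => dimG_mono (Descent.Zs_succ_subset h1 P r)) hd0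
  -- a top-dimensional component `V` of `Z_{r+1}`
  obtain ⟨𝔮ᵥ, h𝔮ᵥ, hdimV⟩ := exists_minimalPrimes_dimG_eq (hZne (r + 1) (by omega))
  obtain ⟨hV, -, hVsub⟩ := isIrred_zeroSet_of_mem_minimalPrimes h𝔮ᵥ
  rw [(hZcl (r + 1)).eq] at hVsub
  generalize hVgen : zeroSet (d₀ := d₀) (d₁ := d₁) (↑𝔮ᵥ : Set (MvPolynomial (Fin d₀ ⊕ Fin d₁) ℂ)) = V at hV hVsub hdimV
  -- the stabiliser `St` of `V` and its identity component `G'`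
  have hStcl : IsClosedG ((MulAction.stabilizer (LinGroup d₀ d₁) V : Subgroup (LinGroup d₀ d₁)) : Set (LinGroup d₀ d₁)) :=
    Descent.isClosedG_stabilizer hV
  have hG'irr : IsIrred ((idComp (MulAction.stabilizer (LinGroup d₀ d₁) V) hStcl : Subgroup (LinGroup d₀ d₁)) : Set (LinGroup d₀ d₁)) :=
    isIrred_idComp _ hStcl
  have hG'St : idComp (MulAction.stabilizer (LinGroup d₀ d₁) V) hStcl ≤ MulAction.stabilizer (LinGroup d₀ d₁) V := idComp_le _ hStcl
  obtain ⟨T, -, hStT⟩ := exists_finset_eq_biUnion_smul_idComp (MulAction.stabilizer (LinGroup d₀ d₁) V) hStcl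
  generalize hG'gen : idComp (MulAction.stabilizer (LinGroup d₀ d₁) V) hStcl = G' at hG'irr hG'St hStT
  -- the transporter `E = {g ; gV ⊆ Z_r} = Z(J)`, `J` box polynomials
  have hJB : Descent.transGens V (Descent.gens S P r) ⊆ Box (d₀ := d₀) (d₁ := d₁) D₀ D₁ 1 :=
    Descent.transGens_subset_Box (Descent.gens_subset_Box hPB r)
  generalize hJgen : Descent.transGens V (Descent.gens S P r) = J at hJB
  have hmemE : ∀ g, g ∈ zeroSet (d₀ := d₀) (d₁ := d₁) J ↔ g • V ⊆ Descent.Zs S P r := fun g => by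
    rw [← hJgen]; exact Descent.mem_zeroSet_transGens_iff
  generalize hEgen : zeroSet (d₀ := d₀) (d₁ := d₁) J = E at hmemE
  have hEJ : E = zeroSet (d₀ := d₀) (d₁ := d₁) J := hEgen.symm
  have hEcl : IsClosedG E := by rw [hEJ]; exact isClosedG_zeroSet _
  have hSE : S ⊆ E := fun σ hσ => (hmemE σ).mpr
    ((Set.smul_set_mono hVsub).trans (Descent.smul_Zs_succ_subset hσ P r))
  have h1E : (1 : LinGroup d₀ d₁) ∈ E := hSE h1
  -- `E · St ⊆ E`, hence cosets of `G'` through points of `E` lie in `E`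
  have hESt : ∀ g ∈ E, ∀ s ∈ MulAction.stabilizer (LinGroup d₀ d₁) V, g * s ∈ E := fun g hg s hs => by
    rw [hmemE, mul_smul, MulAction.mem_stabilizer_iff.mp hs]
    exact (hmemE g).mp hg
  have hcosE : ∀ g ∈ E, g • ((G' : Subgroup (LinGroup d₀ d₁)) : Set (LinGroup d₀ d₁)) ⊆ E := by
    rintro g hg _ ⟨h, hh, rfl⟩
    exact hESt g hg h (hG'St hh)
  -- `E`-translates of `V` are top-dimensional components of `Z_r`
  have htrans : ∀ c ∈ E, ∃ 𝔮 ∈ (vanishing (Descent.Zs S P r)).minimalPrimes,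
      c • V = zeroSet (d₀ := d₀) (d₁ := d₁) ↑𝔮 := fun c hc =>
    (hV.smul c).exists_eq_zeroSet_minimalPrimes (hZcl r) ((hmemE c).mp hc)
      (by rw [dimG_smul, hdimV]; exact hdr.symm)
  -- finitely many `St`-cosets cover `E`
  have hcover : ∃ C : Finset (LinGroup d₀ d₁),
      E ⊆ ⋃ c ∈ C, c • ((MulAction.stabilizer (LinGroup d₀ d₁) V : Subgroup (LinGroup d₀ d₁)) : Set (LinGroup d₀ d₁)) := by
    have hpick : ∀ 𝔮 : Ideal (MvPolynomial (Fin d₀ ⊕ Fin d₁) ℂ), ∃ c : LinGroup d₀ d₁,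
        (∃ c' ∈ E, c' • V = zeroSet (d₀ := d₀) (d₁ := d₁) ↑𝔮) → c • V = zeroSet (d₀ := d₀) (d₁ := d₁) ↑𝔮 := by
      intro 𝔮
      by_cases h : ∃ c' ∈ E, c' • V = zeroSet (d₀ := d₀) (d₁ := d₁) ↑𝔮
      · obtain ⟨c', -, h'⟩ := h; exact ⟨c', fun _ => h'⟩
      · exact ⟨1, fun h' => absurd h' h⟩
    choose pick hpick using hpick
    refine ⟨(comps (Descent.Zs S P r)).image pick, fun c hc => ?_⟩
    obtain ⟨𝔮, h𝔮, hc𝔮⟩ := htrans c hc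
    have hp := hpick 𝔮 ⟨c, hc, hc𝔮⟩
    rw [Set.mem_iUnion₂]
    refine ⟨pick 𝔮, Finset.mem_image_of_mem _ (mem_comps.mpr h𝔮), (pick 𝔮)⁻¹ * c, ?_, by simp [smul_eq_mul]⟩
    have : ((pick 𝔮)⁻¹ * c) • V = V := by rw [mul_smul, hc𝔮, ← hp, inv_smul_smul]
    exact MulAction.mem_stabilizer_iff.mpr this
  obtain ⟨C, hEC⟩ := hcover
  -- `dim E ≤ dim G'`
  have hdimE : dimG E ≤ dimG ((G' : Subgroup (LinGroup d₀ d₁)) : Set (LinGroup d₀ d₁)) := by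
    obtain ⟨𝔯, h𝔯, hdim𝔯⟩ := exists_minimalPrimes_dimG_eq (X := E) ⟨1, h1E⟩
    obtain ⟨h𝔯irr, -, h𝔯sub⟩ := isIrred_zeroSet_of_mem_minimalPrimes h𝔯
    rw [hEcl.eq] at h𝔯sub
    have hsub : zeroSet (d₀ := d₀) (d₁ := d₁) ↑𝔯 ⊆
        ⋃ p ∈ C ×ˢ T, (p.1 * p.2) • ((G' : Subgroup (LinGroup d₀ d₁)) : Set (LinGroup d₀ d₁)) := by
      intro g hg
      obtain ⟨c, hc, hgc⟩ := Set.mem_iUnion₂.mp (hEC (h𝔯sub hg))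
      obtain ⟨s, hs, rfl⟩ := hgc
      have hsSt : s ∈ ((MulAction.stabilizer (LinGroup d₀ d₁) V : Subgroup (LinGroup d₀ d₁)) : Set (LinGroup d₀ d₁)) := hs
      rw [hStT] at hsSt
      obtain ⟨a, ha, hsa⟩ := Set.mem_iUnion₂.mp hsSt
      obtain ⟨g', hg', rfl⟩ := hsa
      rw [Set.mem_iUnion₂]
      exact ⟨(c, a), Finset.mem_product.mpr ⟨hc, ha⟩, g', hg', by simp [smul_eq_mul, mul_assoc]⟩
    obtain ⟨p, -, hp⟩ := h𝔯irr.exists_subset_of_subset_biUnion (C ×ˢ T) _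
      (fun p _ => (hG'irr.isClosedG).smul _) hsub
    rw [← hdim𝔯]
    exact (dimG_mono hp).trans (dimG_smul _ _).le
  -- every coset `σ G'`, `σ ∈ S`, is a top-dimensional component of `E`
  have hcomp : ∀ σ ∈ S, ∃ 𝔮 ∈ (comps E).filter (fun 𝔮 => dimG (zeroSetI (d₀ := d₀) (d₁ := d₁) 𝔮) = dimG E),
      zeroSetI (d₀ := d₀) (d₁ := d₁) 𝔮 = σ • ((G' : Subgroup (LinGroup d₀ d₁)) : Set (LinGroup d₀ d₁)) := by
    intro σ hσ
    have hsub := hcosE σ (hSE hσ)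
    have hdim : dimG (σ • ((G' : Subgroup (LinGroup d₀ d₁)) : Set (LinGroup d₀ d₁))) = dimG E :=
      le_antisymm (dimG_mono hsub) (hdimE.trans (dimG_smul σ _).symm.le)
    obtain ⟨𝔮, h𝔮, heq⟩ := (hG'irr.smul σ).exists_eq_zeroSet_minimalPrimes hEcl hsub hdim
    refine ⟨𝔮, Finset.mem_filter.mpr ⟨mem_comps.mpr h𝔮, ?_⟩, heq.symm⟩
    change dimG (zeroSet (d₀ := d₀) (d₁ := d₁) ↑𝔮) = dimG E
    rw [← heq, hdim]
  -- the count: distinct cosets `σ G'` ↔ distinct classes in `G/G'`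
  have hfib : ∀ x ∈ S, ∀ y ∈ S, (QuotientGroup.mk x : LinGroup d₀ d₁ ⧸ G') = QuotientGroup.mk y ↔
      x • ((G' : Subgroup (LinGroup d₀ d₁)) : Set (LinGroup d₀ d₁)) = y • ((G' : Subgroup (LinGroup d₀ d₁)) : Set (LinGroup d₀ d₁)) := by
    intro x _ y _
    rw [QuotientGroup.eq, leftCoset_eq_iff]
  have hncard : Set.ncard ((QuotientGroup.mk : LinGroup d₀ d₁ → LinGroup d₀ d₁ ⧸ G') '' S) =
      (hS.toFinset.image fun σ => σ • ((G' : Subgroup (LinGroup d₀ d₁)) : Set (LinGroup d₀ d₁))).card := by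
    rw [GaGm.Descent.ncard_image_eq_of_fibres hS _ (fun σ => σ • ((G' : Subgroup (LinGroup d₀ d₁)) : Set (LinGroup d₀ d₁))) hfib,
      show (fun σ => σ • ((G' : Subgroup (LinGroup d₀ d₁)) : Set (LinGroup d₀ d₁))) '' S =
        ↑(hS.toFinset.image fun σ => σ • ((G' : Subgroup (LinGroup d₀ d₁)) : Set (LinGroup d₀ d₁))) by
          rw [Finset.coe_image, hS.coe_toFinset],
      Set.ncard_coe_finset]
  -- the prime of each coset
  have hprime : ∀ Y ∈ hS.toFinset.image (fun σ => σ • ((G' : Subgroup (LinGroup d₀ d₁)) : Set (LinGroup d₀ d₁))),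
      ∃ 𝔮 ∈ (comps E).filter (fun 𝔮 => dimG (zeroSetI (d₀ := d₀) (d₁ := d₁) 𝔮) = dimG E), zeroSetI (d₀ := d₀) (d₁ := d₁) 𝔮 = Y := by
    intro Y hY
    obtain ⟨σ, hσ, rfl⟩ := Finset.mem_image.mp hY
    exact hcomp σ (hS.mem_toFinset.mp hσ)
  choose! ψ hψmem hψeq using hprime
  have hψinj : Set.InjOn ψ ↑(hS.toFinset.image (fun σ => σ • ((G' : Subgroup (LinGroup d₀ d₁)) : Set (LinGroup d₀ d₁)))) := by
    intro Y hY Y' hY' h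
    rw [← hψeq Y hY, ← hψeq Y' hY', h]
  have hsum : ∑ Y ∈ hS.toFinset.image (fun σ => σ • ((G' : Subgroup (LinGroup d₀ d₁)) : Set (LinGroup d₀ d₁))),
      mult D₀ D₁ Y ≤ (d₀ + d₁).factorial * D₀ ^ d₀ * D₁ ^ d₁ := by
    calc ∑ Y ∈ hS.toFinset.image (fun σ => σ • ((G' : Subgroup (LinGroup d₀ d₁)) : Set (LinGroup d₀ d₁))), mult D₀ D₁ Y
        = ∑ Y ∈ hS.toFinset.image (fun σ => σ • ((G' : Subgroup (LinGroup d₀ d₁)) : Set (LinGroup d₀ d₁))),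
            mult D₀ D₁ (zeroSetI (d₀ := d₀) (d₁ := d₁) (ψ Y)) :=
          Finset.sum_congr rfl fun Y hY => by rw [hψeq Y hY]
      _ = ∑ 𝔮 ∈ (hS.toFinset.image (fun σ => σ • ((G' : Subgroup (LinGroup d₀ d₁)) : Set (LinGroup d₀ d₁)))).image ψ,
            mult D₀ D₁ (zeroSetI (d₀ := d₀) (d₁ := d₁) 𝔮) :=
          (Finset.sum_image (f := fun 𝔮 => mult D₀ D₁ (zeroSetI (d₀ := d₀) (d₁ := d₁) 𝔮)) hψinj).symm
      _ ≤ ∑ 𝔮 ∈ (comps E).filter (fun 𝔮 => dimG (zeroSetI (d₀ := d₀) (d₁ := d₁) 𝔮) = dimG E),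
            mult D₀ D₁ (zeroSetI (d₀ := d₀) (d₁ := d₁) 𝔮) :=
          Finset.sum_le_sum_of_subset_of_nonneg (fun 𝔮 h𝔮 => by
            obtain ⟨Y, hY, rfl⟩ := Finset.mem_image.mp h𝔮; exact hψmem Y hY) (fun _ _ _ => Nat.zero_le _)
      _ ≤ (d₀ + d₁).factorial * D₀ ^ d₀ * D₁ ^ d₁ := by
          rw [hEJ]; exact sum_mult_le_of_subset_Box hD₀ hD₁ hJB ⟨1, hEJ ▸ h1E⟩
  have hconst : ∀ Y ∈ hS.toFinset.image (fun σ => σ • ((G' : Subgroup (LinGroup d₀ d₁)) : Set (LinGroup d₀ d₁))),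
      mult D₀ D₁ Y = mult D₀ D₁ ((G' : Subgroup (LinGroup d₀ d₁)) : Set (LinGroup d₀ d₁)) := by
    intro Y hY
    obtain ⟨σ, -, rfl⟩ := Finset.mem_image.mp hY
    exact mult_smul hD₀ hD₁ hG'irr σ
  rw [Finset.sum_congr rfl hconst, Finset.sum_const, smul_eq_mul] at hsum
  -- assemble
  obtain ⟨v₀, hv₀⟩ := hV.nonempty
  obtain ⟨𝔮₁, h𝔮₁, h𝔮₁eq⟩ := hcomp 1 h1
  refine ⟨G', hG'irr, ⟨J, 𝔮₁, hJB, ?_, by rw [h𝔮₁eq, one_smul]⟩, ⟨v₀, fun h hh => ?_⟩, ?_⟩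
  · rw [← hEJ]; exact (Finset.mem_filter.mp h𝔮₁).1
  · -- `v₀ h = h v₀ ∈ hV = V ⊆ Z_{r+1} ⊆ Z_0 = Z(P)`
    have hhSt : h • V = V := MulAction.mem_stabilizer_iff.mp (hG'St hh)
    have hmem : v₀ * h ∈ V := by rw [mul_comm, ← hhSt]; exact Set.smul_mem_smul_set hv₀
    exact Descent.mem_Zs_zero_iff.mp (Descent.Zs_antitone h1 P (Nat.zero_le (r + 1)) (hVsub hmem))
  · rw [hncard]; exact hsum

end LinGroup

end Literature.NumberTheory.Transcendental
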